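import Summits.QuantumFields.BalabanUV.T4Continuum.Spine.NE3.AxialGaugeDivergence
import Summits.QuantumFields.BalabanUV.T4Continuum.Support.NE3FluxGradientDictionary
import HarnessLib

/-!
# T⁴ programme, node NE3 — census R39 (closing file): THE CURVED (H0_W) AND THE END's `hK(W)` WITH LEVEL-UNIFORM CONSTANTS
# (non-vacuity of the line of `AxialGaugeDivergence.supRegularity_of_plaqGrad`: the choice `R = ⌈8d(frameC+d)M⌉`)

Cell `pub-balaban-gaps` (YM blitz, track G2, seat `ne3`, unit `pub-balaban-gaps-ne3-g8`; writer prover-pub-balaban-gaps-ne3-g8-0, 2026-08-24),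
census `run/shared/lean/pub/pub-balaban-gaps/ne/NE3.md` §4 R39 door (c).  WHY.  `Spine/NE3/AxialGaugeDivergence.supRegularity_of_plaqGrad` proves
the curved sup regularity (H0_W) of the END's sup letter at every background `W` of the class with covariant plaquette gradients `≤ x₁`, for every
integer radius `R ≥ 1` satisfying ONE line
`2d·C_U∕R + (4Rδ + 24Rd·a² + 2a)·C_U + 8Rd·a ≤ 1∕2`, `C_U = (frameC + d)·M`, `a = 2d(R+1)x`, `δ = 2d²(R+1)x₁ + 8d³(R+1)²x²`, `M = L^{j+1}`.
This file DISCHARGES the line: with `F = frameC d L + d` and the choice `R = ⌈8dFM⌉` it holds as soon as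
`23040·d⁴·F²·(M²x) ≤ 1` and `11520·d⁴·F³·(M³x₁) ≤ 1` — conditions on the LEVEL-FREE letters `M²x` (= `L²·b` for the class radius `b·(L^j)^{−2}`)
and `M³x₁` (= `L³·c` for the [B11] Thm 1 (10)-type gradient radius `c·(L^j)^{−3}`), uniform in `j` and in the volume `N`.  CONTENT ([folklore]; 0 sorry):

* §1 `line_of_small` — the real inequality: the line holds for every `R ≥ 8dFM` under four explicit smallness conditions; `exists_radius_line` — the
  choice `R = ⌈8dFM⌉ ≤ 9dFM` meets them under the two level-free conditions above.
* §2 **`supRegularity_uniform`** — (H0_W) with LEVEL-UNIFORM constants: for `u ∈ avgKernelGauges L N (j+1) W`,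
  `‖D_W u‖_∞ ≤ 36d·F·M·‖Δ_W u‖_∞` and `‖u‖_∞ ≤ 36d·F²·M²·‖Δ_W u‖_∞` (`c₁ = 36d(frameC+d)`, `c₀ = 36d(frameC+d)²`, depending on `d, L` only);
  **`supRegularity_uniform_of_fluxGrad`** — the same from the FLUX-gradient datum `‖covGrad W (flux W)‖ ≤ g` of `MinimalActionRefine.RegularSup`
  (`x₁ = 2g`, `Support/NE3FluxGradientDictionary`), for `x ≤ 1∕4`.
* §3 **`landauCorrectionSupB8_uniform`** — THE END's `hK(W)`: `LandauCorrectionSupB8 hL j hWu hx hs hWx N hθ K₀ K₁` with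
  `K₀ = d·liftC·(6 + 2(d+1)M²x)·36dF²·c_R∕(1−θ)`, `K₁ = d·liftC·(6 + 2(d+1)M²x)·36dF·c_R∕(1−θ)` ⇐ the two level-free conditions ∧ (HR_W) with constant
  `c_R` (`LandauCorrectionSupB8Flat.landauCorrectionSupB8_of_supFacts`).  What remains of the END's `hK` at a curved `W` after this file is EXACTLY
  (HR_W) (the Landau-projection sup bound; proved at `W = 1` in `Spine/NE3/LandauProjectionSupFlat`) plus the two regularity radii of `W`.

HONEST: lattice analysis at a fixed background; nothing of Bałaban's is asserted; NE3 is NOT proved here; spine count unchanged; nothing about `ℝ⁴`,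
a mass gap or Clay.
-/

set_option autoImplicit false

open scoped BigOperators Matrix Matrix.Norms.L2Operator
open NormedSpace Finset

namespace Summit.QuantumFields.BalabanUV.T4Continuum.NE3.SupRegularityCurvedUniform

open Literature.MathematicalPhysics.QuantumFieldTheory.Balaban1983to89
open B7Prop1Explicit B7Prop2Explicit
open T4AveragingDeficitWall (Ad IsUnitaryCfg SmallField covGrad flux Plane)
open T4AveragingDeficitWallBoundary (IsPeriodicCfg periodBox)
open AveragingDeficitMultiLevelPrep (LevelSmall)
open BlockAveragePushDirGauge (gaugeDir)
open NE3QbarIterCovLiftPrep (cruxC liftC)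
open NE3CovariantCalculus (hsR)
open NE3RightInverseSupLetters (frameC)
open NE3.PairLandauB8 (avgKernelGauges covLapSite)
open NE3.LandauProjectionSupShape (LandauCorrectionSupB8)
open NE3.LandauCorrectionSupB8Flat (landauCorrectionSupB8_of_supFacts)
open NE3.AxialGaugeDivergence (supRegularity_of_plaqGrad)
open NE3FluxGradientDictionary (norm_Ad_hol_sub_hol_le_of_fluxGrad)

noncomputable section

variable {d : ℕ} {n : Type*} [Fintype n] [DecidableEq n]

/-! ## §1 The line is non-vacuous: `R = ⌈8d(frameC + d)M⌉` -/

/-- The line of `supRegularity_of_plaqGrad` holds for every radius `R ≥ 8dFM` under four explicit smallness conditions on `x, x₁` (pure algebra). [folklore] -/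
theorem line_of_small {R : ℕ} (hR1 : 1 ≤ R) {F M x x₁ : ℝ} (hR : 8 * (d : ℝ) * F * M ≤ R)
    (h1 : 128 * (d : ℝ) ^ 2 * R * ((R : ℝ) + 1) * F * M * x₁ ≤ 1)
    (h2 : 2048 * (d : ℝ) ^ 3 * R * ((R : ℝ) + 1) ^ 2 * F * M * x ^ 2 ≤ 1)
    (h3 : 64 * (d : ℝ) * ((R : ℝ) + 1) * F * M * x ≤ 1)
    (h4 : 256 * (d : ℝ) ^ 2 * R * ((R : ℝ) + 1) * x ≤ 1) :
    2 * (d : ℝ) * (F * M) / R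
        + (4 * R * (2 * (d : ℝ) ^ 2 * (R + 1) * x₁ + 8 * (d : ℝ) ^ 3 * ((R : ℝ) + 1) ^ 2 * x ^ 2)
            + 24 * R * d * (2 * (d : ℝ) * (R + 1) * x) ^ 2 + 2 * (2 * (d : ℝ) * (R + 1) * x)) * (F * M)
        + 8 * R * d * (2 * (d : ℝ) * (R + 1) * x) ≤ 1 / 2 := by
  have hR0 : (0 : ℝ) < R := by exact_mod_cast hR1
  have hfirst : 2 * (d : ℝ) * (F * M) / R ≤ 1 / 4 := by
    rw [div_le_iff₀ hR0]; linarith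
  have hrest : (4 * R * (2 * (d : ℝ) ^ 2 * (R + 1) * x₁ + 8 * (d : ℝ) ^ 3 * ((R : ℝ) + 1) ^ 2 * x ^ 2)
            + 24 * R * d * (2 * (d : ℝ) * (R + 1) * x) ^ 2 + 2 * (2 * (d : ℝ) * (R + 1) * x)) * (F * M)
        + 8 * R * d * (2 * (d : ℝ) * (R + 1) * x)
      = (128 * (d : ℝ) ^ 2 * R * ((R : ℝ) + 1) * F * M * x₁) / 16 + (2048 * (d : ℝ) ^ 3 * R * ((R : ℝ) + 1) ^ 2 * F * M * x ^ 2) / 16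
        + (64 * (d : ℝ) * ((R : ℝ) + 1) * F * M * x) / 16 + (256 * (d : ℝ) ^ 2 * R * ((R : ℝ) + 1) * x) / 16 := by ring
  rw [add_assoc, hrest]
  linarith

/-- **The choice of the radius**: for `F, M ≥ 1`, `d ≥ 1` and the two LEVEL-FREE conditions `23040·d⁴F²M²·x ≤ 1`, `11520·d⁴F³M³·x₁ ≤ 1` the radius
`R = ⌈8dFM⌉` satisfies `1 ≤ R ≤ 9dFM` and the line. [folklore] -/
theorem exists_radius_line (hd : 1 ≤ d) {F M x x₁ : ℝ} (hF : 1 ≤ F) (hM : 1 ≤ M) (hx : 0 ≤ x) (hx₁ : 0 ≤ x₁)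
    (hbx : 23040 * (d : ℝ) ^ 4 * F ^ 2 * M ^ 2 * x ≤ 1) (hcx : 11520 * (d : ℝ) ^ 4 * F ^ 3 * M ^ 3 * x₁ ≤ 1) :
    ∃ R : ℕ, 1 ≤ R ∧ (R : ℝ) ≤ 9 * d * F * M ∧
      2 * (d : ℝ) * (F * M) / R
        + (4 * R * (2 * (d : ℝ) ^ 2 * (R + 1) * x₁ + 8 * (d : ℝ) ^ 3 * ((R : ℝ) + 1) ^ 2 * x ^ 2)
            + 24 * R * d * (2 * (d : ℝ) * (R + 1) * x) ^ 2 + 2 * (2 * (d : ℝ) * (R + 1) * x)) * (F * M)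
        + 8 * R * d * (2 * (d : ℝ) * (R + 1) * x) ≤ 1 / 2 := by
  have hd1 : (1 : ℝ) ≤ d := by exact_mod_cast hd
  have hdFM : 1 ≤ (d : ℝ) * F * M := by nlinarith [mul_le_mul hd1 hF zero_le_one (zero_le_one.trans hd1)]
  set R : ℕ := ⌈8 * (d : ℝ) * F * M⌉₊ with hRdef
  have hRge : 8 * (d : ℝ) * F * M ≤ R := Nat.le_ceil _
  have hRlt : (R : ℝ) < 8 * (d : ℝ) * F * M + 1 := Nat.ceil_lt_add_one (by positivity)
  have hR9 : (R : ℝ) ≤ 9 * d * F * M := by linarith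
  have hR1 : 1 ≤ R := Nat.one_le_ceil_iff.mpr (by positivity)
  have hρ : (R : ℝ) + 1 ≤ 10 * d * F * M := by linarith
  have hR0 : (0 : ℝ) ≤ R := by positivity
  refine ⟨R, hR1, hR9, line_of_small hR1 hRge ?_ ?_ ?_ ?_⟩
  · -- `128 d² R (R+1) F M x₁ ≤ 128 d²·9dFM·10dFM·FM·x₁ = 11520 d⁴F³M³ x₁ ≤ 1`
    calc 128 * (d : ℝ) ^ 2 * R * ((R : ℝ) + 1) * F * M * x₁
        ≤ 128 * (d : ℝ) ^ 2 * (9 * d * F * M) * (10 * d * F * M) * F * M * x₁ := by gcongr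
      _ = 11520 * (d : ℝ) ^ 4 * F ^ 3 * M ^ 3 * x₁ := by ring
      _ ≤ 1 := hcx
  · -- `2048 d³ R (R+1)² F M x² ≤ 1843200 d⁶F⁴M⁴x² ≤ (23040 d⁴F²M²x)² ≤ 1`
    have hy : (d : ℝ) ^ 4 * F ^ 2 * M ^ 2 * x ≤ 1 / 23040 := by linarith
    have hy0 : 0 ≤ (d : ℝ) ^ 4 * F ^ 2 * M ^ 2 * x := by positivity
    calc 2048 * (d : ℝ) ^ 3 * R * ((R : ℝ) + 1) ^ 2 * F * M * x ^ 2
        ≤ 2048 * (d : ℝ) ^ 3 * (9 * d * F * M) * (10 * d * F * M) ^ 2 * F * M * x ^ 2 := by gcongr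
      _ = 1843200 * ((d : ℝ) ^ 6 * F ^ 4 * M ^ 4 * x ^ 2) := by ring
      _ ≤ 1843200 * ((d : ℝ) ^ 4 * F ^ 2 * M ^ 2 * x) ^ 2 := by
          gcongr
          have hd2 : (d : ℝ) ^ 6 ≤ (d : ℝ) ^ 8 := pow_le_pow_right₀ hd1 (by norm_num)
          nlinarith [hd2, sq_nonneg (F ^ 2 * M ^ 2 * x), mul_nonneg (mul_nonneg (pow_nonneg (zero_le_one.trans hF) 4) (pow_nonneg (zero_le_one.trans hM) 4)) (sq_nonneg x)]
      _ ≤ 1843200 * (1 / 23040) ^ 2 := by gcongr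
      _ ≤ 1 := by norm_num
  · calc 64 * (d : ℝ) * ((R : ℝ) + 1) * F * M * x
        ≤ 64 * (d : ℝ) * (10 * d * F * M) * F * M * x := by gcongr
      _ = 640 * ((d : ℝ) ^ 2 * (F ^ 2 * M ^ 2 * x)) := by ring
      _ ≤ 640 * ((d : ℝ) ^ 4 * (F ^ 2 * M ^ 2 * x)) := by
          have hd2 : (d : ℝ) ^ 2 ≤ (d : ℝ) ^ 4 := pow_le_pow_right₀ hd1 (by norm_num)
          have h0 : 0 ≤ F ^ 2 * M ^ 2 * x := by positivity
          nlinarith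
      _ ≤ 1 := by linarith
  · calc 256 * (d : ℝ) ^ 2 * R * ((R : ℝ) + 1) * x
        ≤ 256 * (d : ℝ) ^ 2 * (9 * d * F * M) * (10 * d * F * M) * x := by gcongr
      _ = 23040 * (d : ℝ) ^ 4 * F ^ 2 * M ^ 2 * x := by ring
      _ ≤ 1 := hbx

/-- `1 ≤ frameC d L + d` for `d ≥ 1`. [folklore] -/
theorem one_le_frameC_add (hd : 1 ≤ d) (L : ℕ) : (1 : ℝ) ≤ frameC d L + d := by
  have h0 : 0 ≤ frameC d L := by unfold frameC; positivity
  have hd1 : (1 : ℝ) ≤ d := by exact_mod_cast hd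
  linarith

/-! ## §2 (H0_W) with level-uniform constants -/

/-- **THE CURVED (H0_W) WITH LEVEL-UNIFORM CONSTANTS** (`d ≥ 1`, `L ≥ 2`, `N ≥ 1`, class at level `j`, `M = L^{j+1}`, `F = frameC d L + d`): for unitary
`(N·M)`-periodic `W` with `SmallField W x`, covariant plaquette gradients `≤ x₁`, and the two LEVEL-FREE conditions `23040·d⁴F²·M²x ≤ 1`, `11520·d⁴F³·M³x₁ ≤ 1`,
every `u ∈ avgKernelGauges L N (j+1) W` obeys `‖D_W u‖_∞ ≤ 36d·F·M·‖Δ_W u‖_∞` and `‖u‖_∞ ≤ 36d·F²·M²·‖Δ_W u‖_∞`. [folklore] -/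
theorem supRegularity_uniform [Nonempty n] (hd : 1 ≤ d) {L N : ℕ} [NeZero N] (hL : 2 ≤ L) (j : ℕ)
    {W : Site d → Fin d → (Matrix n n ℂ)ˣ} {x x₁ : ℝ} (hWu : IsUnitaryCfg W) (hWP : IsPeriodicCfg W ((N * L ^ (j + 1) : ℕ) : ℤ))
    (hx : 0 ≤ x) (hs : LevelSmall d L j x) (hWx : SmallField W x) (hx10 : 0 ≤ x₁)
    (hgrad : ∀ (p : Site d) (μ κ : Fin d), κ ≠ μ →
      ‖Ad (W p μ) ((hol W (p + e μ) (plaqWord κ μ) : (Matrix n n ℂ)ˣ) : Matrix n n ℂ) - ((hol W p (plaqWord κ μ) : (Matrix n n ℂ)ˣ) : Matrix n n ℂ)‖ ≤ x₁)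
    (hbx : 23040 * (d : ℝ) ^ 4 * (frameC d L + d) ^ 2 * ((L : ℝ) ^ (j + 1)) ^ 2 * x ≤ 1)
    (hcx : 11520 * (d : ℝ) ^ 4 * (frameC d L + d) ^ 3 * ((L : ℝ) ^ (j + 1)) ^ 3 * x₁ ≤ 1)
    {u : Site d → Matrix n n ℂ} (hu : u ∈ avgKernelGauges (d := d) (n := n) L N (j + 1) W) {B : ℝ} (hB : ∀ y : Site d, ‖covLapSite W u y‖ ≤ B) :
    (∀ (y : Site d) (μ : Fin d), ‖gaugeDir W u y μ‖ ≤ 36 * d * (frameC d L + d) * (L : ℝ) ^ (j + 1) * B) ∧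
      (∀ y : Site d, ‖u y‖ ≤ 36 * d * (frameC d L + d) ^ 2 * ((L : ℝ) ^ (j + 1)) ^ 2 * B) := by
  have hF := one_le_frameC_add hd L
  have hM : (1 : ℝ) ≤ (L : ℝ) ^ (j + 1) := one_le_pow₀ (by exact_mod_cast (show 1 ≤ L by omega))
  have hB0 : 0 ≤ B := (norm_nonneg _).trans (hB 0)
  obtain ⟨R, hR1, hR9, hline⟩ := exists_radius_line hd hF hM hx hx10 hbx hcx
  obtain ⟨hD, hU⟩ := supRegularity_of_plaqGrad hd hL j hWu hWP hx hs hWx hx10 hgrad hu hB hR1 hline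
  have hF0 : 0 ≤ frameC d L + d := zero_le_one.trans hF
  refine ⟨fun y μ => (hD y μ).trans ?_, fun y => (hU y).trans ?_⟩
  · calc 4 * (R : ℝ) * B ≤ 4 * (9 * d * (frameC d L + d) * (L : ℝ) ^ (j + 1)) * B := by gcongr
      _ = 36 * d * (frameC d L + d) * (L : ℝ) ^ (j + 1) * B := by ring
  · calc 4 * ((frameC d L + d) * (L : ℝ) ^ (j + 1)) * R * B ≤ 4 * ((frameC d L + d) * (L : ℝ) ^ (j + 1)) * (9 * d * (frameC d L + d) * (L : ℝ) ^ (j + 1)) * B := by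
          gcongr
      _ = 36 * d * (frameC d L + d) ^ 2 * ((L : ℝ) ^ (j + 1)) ^ 2 * B := by ring

/-- **(H0_W) FROM THE FLUX-GRADIENT DATUM** (`MinimalActionRefine.RegularSup` letters): `SmallField W x` with `x ≤ 1∕4` and `‖covGrad W (flux W)‖ ≤ g` (ordered planes)
(`g ≥ 0`) give the hypothesis of `supRegularity_uniform` with `x₁ = 2g` (`NE3FluxGradientDictionary.norm_Ad_hol_sub_hol_le_of_fluxGrad`). [folklore] -/
theorem supRegularity_uniform_of_fluxGrad [Nonempty n] (hd : 1 ≤ d) {L N : ℕ} [NeZero N] (hL : 2 ≤ L) (j : ℕ)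
    {W : Site d → Fin d → (Matrix n n ℂ)ˣ} {x g : ℝ} (hWu : IsUnitaryCfg W) (hWP : IsPeriodicCfg W ((N * L ^ (j + 1) : ℕ) : ℤ))
    (hx : 0 ≤ x) (hx4 : x ≤ 1 / 4) (hs : LevelSmall d L j x) (hWx : SmallField W x) (hg0 : 0 ≤ g)
    (hg : ∀ (z : Site d) (μ : Fin d) (π : Plane d), ‖covGrad W (flux W) z μ π‖ ≤ g)
    (hbx : 23040 * (d : ℝ) ^ 4 * (frameC d L + d) ^ 2 * ((L : ℝ) ^ (j + 1)) ^ 2 * x ≤ 1)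
    (hcg : 23040 * (d : ℝ) ^ 4 * (frameC d L + d) ^ 3 * ((L : ℝ) ^ (j + 1)) ^ 3 * g ≤ 1)
    {u : Site d → Matrix n n ℂ} (hu : u ∈ avgKernelGauges (d := d) (n := n) L N (j + 1) W) {B : ℝ} (hB : ∀ y : Site d, ‖covLapSite W u y‖ ≤ B) :
    (∀ (y : Site d) (μ : Fin d), ‖gaugeDir W u y μ‖ ≤ 36 * d * (frameC d L + d) * (L : ℝ) ^ (j + 1) * B) ∧
      (∀ y : Site d, ‖u y‖ ≤ 36 * d * (frameC d L + d) ^ 2 * ((L : ℝ) ^ (j + 1)) ^ 2 * B) := by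
  have hgrad : ∀ (p : Site d) (μ κ : Fin d), κ ≠ μ →
      ‖Ad (W p μ) ((hol W (p + e μ) (plaqWord κ μ) : (Matrix n n ℂ)ˣ) : Matrix n n ℂ) - ((hol W p (plaqWord κ μ) : (Matrix n n ℂ)ˣ) : Matrix n n ℂ)‖ ≤ 2 * g :=
    fun p μ κ hκμ => norm_Ad_hol_sub_hol_le_of_fluxGrad hWu hWx hx4 hg p μ hκμ
  refine supRegularity_uniform hd hL j hWu hWP hx hs hWx (by positivity) hgrad hbx ?_ hu hB
  calc 11520 * (d : ℝ) ^ 4 * (frameC d L + d) ^ 3 * ((L : ℝ) ^ (j + 1)) ^ 3 * (2 * g)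
      = 23040 * (d : ℝ) ^ 4 * (frameC d L + d) ^ 3 * ((L : ℝ) ^ (j + 1)) ^ 3 * g := by ring
    _ ≤ 1 := hcg

/-! ## §3 THE END's `hK(W)` with level-uniform constants -/

/-- **THE END's SUP LETTER AT A CURVED BACKGROUND, LEVEL-UNIFORM CONSTANTS** (`d ≥ 1`, `L ≥ 2`, `N ≥ 1`, `j`; `M = L^{j+1}`, `F = frameC d L + d`, `θ = cruxC·M²x < 1`):
`LandauCorrectionSupB8 hL j hWu hx hs hWx N hθ K₀ K₁`, `K₀ = d·liftC·(6 + 2(d+1)M²x)·(36dF²)·c_R∕(1−θ)`, `K₁ = d·liftC·(6 + 2(d+1)M²x)·(36dF)·c_R∕(1−θ)` ⇐ covariant plaquette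
gradients `≤ x₁`, the two level-free conditions, and (HR_W) with constant `c_R`. [folklore] -/
theorem landauCorrectionSupB8_uniform [Nonempty n] (hd : 1 ≤ d) {L : ℕ} (hL : 2 ≤ L) (j : ℕ)
    {W : Site d → Fin d → (Matrix n n ℂ)ˣ} {x x₁ : ℝ} (hWu : IsUnitaryCfg W) (hx : 0 ≤ x) (hs : LevelSmall d L j x) (hWx : SmallField W x)
    (N : ℕ) [NeZero N] (hθ : cruxC d L * (((L : ℝ) ^ (j + 1)) ^ 2 * x) < 1) (hWP : IsPeriodicCfg W ((N * L ^ (j + 1) : ℕ) : ℤ)) (hx10 : 0 ≤ x₁)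
    (hgrad : ∀ (p : Site d) (μ κ : Fin d), κ ≠ μ →
      ‖Ad (W p μ) ((hol W (p + e μ) (plaqWord κ μ) : (Matrix n n ℂ)ˣ) : Matrix n n ℂ) - ((hol W p (plaqWord κ μ) : (Matrix n n ℂ)ˣ) : Matrix n n ℂ)‖ ≤ x₁)
    (hbx : 23040 * (d : ℝ) ^ 4 * (frameC d L + d) ^ 2 * ((L : ℝ) ^ (j + 1)) ^ 2 * x ≤ 1)
    (hcx : 11520 * (d : ℝ) ^ 4 * (frameC d L + d) ^ 3 * ((L : ℝ) ^ (j + 1)) ^ 3 * x₁ ≤ 1) {cR : ℝ}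
    (hRW : ∀ (F : Site d → Matrix n n ℂ), (∀ y : Site d, F y ∈ skewAdjoint (Matrix n n ℂ)) →
      (∀ (y : Site d) (i : Fin d), F (y + ((N * L ^ (j + 1) : ℕ) : ℤ) • e i) = F y) →
      ∀ μ ∈ avgKernelGauges (d := d) (n := n) L N (j + 1) W,
        (∀ ν ∈ avgKernelGauges (d := d) (n := n) L N (j + 1) W,
          ∑ y ∈ periodBox (d := d) (N * L ^ (j + 1)), hsR (F y + covLapSite W μ y) (covLapSite W ν y) = 0) →
        ∀ B : ℝ, (∀ y : Site d, ‖F y‖ ≤ B) → ∀ y : Site d, ‖covLapSite W μ y‖ ≤ cR * B) :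
    LandauCorrectionSupB8 hL j hWu hx hs hWx N hθ
      ((d : ℝ) * liftC d * (6 + 2 * ((d : ℝ) + 1) * (((L : ℝ) ^ (j + 1)) ^ 2 * x)) * (36 * d * (frameC d L + d) ^ 2) * cR
        / (1 - cruxC d L * (((L : ℝ) ^ (j + 1)) ^ 2 * x)))
      ((d : ℝ) * liftC d * (6 + 2 * ((d : ℝ) + 1) * (((L : ℝ) ^ (j + 1)) ^ 2 * x)) * (36 * d * (frameC d L + d)) * cR
        / (1 - cruxC d L * (((L : ℝ) ^ (j + 1)) ^ 2 * x))) :=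
  landauCorrectionSupB8_of_supFacts hL j hWu hx hs hWx N hθ hWP
    (fun u hu B hB => by
      obtain ⟨hD, hU⟩ := supRegularity_uniform hd hL j hWu hWP hx hs hWx hx10 hgrad hbx hcx hu hB
      exact ⟨fun y => by have := hU y; linarith [this], fun y μ => by have := hD y μ; linarith [this]⟩)
    hRW

end

end Summit.QuantumFields.BalabanUV.T4Continuum.NE3.SupRegularityCurvedUniform
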